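import Literature.AnabelianGeometry.SemiGraphs.TieLabelsOfDetected
import Literature.AnabelianGeometry.Anabelioids.ExactFunctorProofs
import HarnessLib

/-!
# The TIE from detection, LOCALISED: labels injective over the detected edges only
# ([SemiAnbd] Def. 2.2 (i) p. 23, Rem. 2.2.1 p. 24, proof of Cor. 2.7 (i) p. 30)

Mochizuki, *Semi-graphs of anabelioids*, Publ. RIMS **42** (2006) 221–322, §2: Def. 2.2 (i) p. 23 (the
finite étale covering `ℋ → 𝒦` attached to `A ∈ B(𝒦)`: "the vertices (respectively, edges) of `𝔾′` that
lie over a vertex `v` (respectively, an edge `e`) correspond to the connected components of `S_v`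
(respectively, `T_e`)"), Rem. 2.2.1 p. 24, proof of Cor. 2.7 (i) p. 30
[cite: MochizukiSemiAnbd2006, Def. 2.2(i) p.23].

PROOF-ONLY (abc-iut cell, layer L3; FACT-LIST row F-1487 `covering_subgraphComponents_doubleCosets`
AS TYPED, CLASS route «regluing invisibility / mass balance» of abc-iut-w4-d080, brick R6c «LOCALISED
TIE»; seat abc-iut-f-161 (gen 13), L3-lead ζ3; SHAPES `HOME/staging/f/f-161/g13/SHAPES-R6c.md`).

abc-iut-L3-d2's `tie_bijective_of_sectionE_surjective` turns detection of EVERY edge-cell of `𝔾_A`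
into BIJECTIVE section labels `(O, O_E)` (mass balance on the finite fibres, then abc-iut-f-161's
labelled lift over the CONNECTED `𝔾_A`).  The two consumers of the labels (abc-iut-L3-d3's sheet walk
`Hom.sectionFibres_saturate` and its step `Hom.walkStep_vertex_to_edge`) use edge-label surjectivity
only at cells over the edges of the sub-graph `ℍ` and vertex-label injectivity only at vertices over
`ℍ`.  This file proves exactly that much from exactly that much detection:

* `tie_localLabels_of_sectionE_surjectiveOn` — **THE LOCALISED TIE**: if `ψ : ℋ → 𝒦` is locally the
  covering attached to `A`, globally so through `(αψ, e_ψ)`, vertex-aligned, and every edge-cell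
  `(e, Q)` of `𝔾_A` over an edge `e` of a given set `S` is detected (is the section label of some edge of
  `ℋ` over `e`), then the section labels `(O, O_E)` — defined on ALL of `ℋ`, characterised by the
  factorisation of the tautological section, compatible with abutment (branch clause) — are (2i)
  INJECTIVE on the edges over `S` (mass balance on ONE finite fibre at a time: the fibre of `ψ` over `e`
  has `|π₀(A_e)|` elements by the local clause), (2s) SURJECTIVE onto the cells over `S`, and (1)
  INJECTIVE on the vertices over any vertex carrying a branch of an `S`-edge (star count
  `natCard_componentOver_eq_le_natCard_branches` at that branch + (2i) + `branchMap_injOn`; NO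
  connectedness of `ℋ`, `𝒦` or `𝔾_A` is used).

No `def`, no instance, no new `Prop`; a strict generalisation of the hypotheses of
`tie_localLabels_of_sectionE_surjective` (which is not restated); typed ≠ proved for F-1487 AS TYPED
(OPEN-AS-TYPED, L3-lead δ22); CLASS route ≠ the fact; nothing here takes a side on [IUTchIII] Cor. 3.12.
-/

namespace Literature.AnabelianGeometry.SemiGraphs

namespace SemiGraphOfAnabelioids

namespace Hom

open CategoryTheory CategoryTheory.Limits CategoryTheory.PreGaloisCategory
open Literature.AnabelianGeometry.Anabelioids

universe v₁ u₁ u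

/-! ### Mass balance on one fibre -/

/-- **Mass balance on ONE finite fibre.**  For a map `a ↦ (p a, ℓ a)` into `Σ i, F i` and an index
`i` whose fibre `p⁻¹(i)` is in bijection with the FINITE set `F i`: if every point of `{i} × F i` is
hit, then the map is injective on `p⁻¹(i)` (a surjection between finite sets of the same cardinality
is a bijection). [folklore] -/
private theorem eq_of_sigma_eq_of_surjOn_fiber {ι : Type*} {α : Type*} (p : α → ι) (F : ι → Type*)
    (i : ι) [Finite (F i)] (ℓ : ∀ a, F (p a)) (eqv : Nonempty ({a // p a = i} ≃ F i))
    (hs : ∀ y : F i, ∃ a, (⟨p a, ℓ a⟩ : Σ i, F i) = ⟨i, y⟩)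
    {a a' : α} (ha : p a = i) (h : (⟨p a, ℓ a⟩ : Σ i, F i) = ⟨p a', ℓ a'⟩) : a = a' := by
  have hp : p a = p a' := congrArg Sigma.fst h
  have hℓ : HEq (ℓ a) (ℓ a') := (Sigma.mk.inj_iff.mp h).2
  let g : {x // p x = i} → F i := fun x => cast (congrArg F x.2) (ℓ x.1)
  have hg : Function.Surjective g := by
    intro y
    obtain ⟨x, hx⟩ := hs y
    exact ⟨⟨x, congrArg Sigma.fst hx⟩, cast_eq_iff_heq.mpr (Sigma.mk.inj_iff.mp hx).2⟩
  haveI : Finite {x // p x = i} := Finite.of_equiv _ eqv.some.symm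
  have hginj : Function.Injective g := (Finite.injective_iff_surjective_of_equiv eqv.some).mpr hg
  have key : g ⟨a, ha⟩ = g ⟨a', hp.symm.trans ha⟩ := by
    change cast _ (ℓ a) = cast _ (ℓ a')
    rw [cast_eq_iff_heq]
    exact hℓ.trans (cast_heq _ _).symm
  exact congrArg Subtype.val (hginj key)

/-! ### The localised TIE -/

variable {ℋ 𝒦 : SemiGraphOfAnabelioids.{v₁, u₁, u}} (ψ : Hom ℋ 𝒦) (A : 𝒦.BObj)
  [HasBinaryProducts 𝒦.BObj] (αψ : Over A ⥤ ℋ.BObj) [αψ.IsEquivalence]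
  (eψ : ψ.pullbackFunctor ≅ Over.star A ⋙ αψ)

omit [HasBinaryProducts 𝒦.BObj] [αψ.IsEquivalence] in
/-- Bookkeeping: a re-indexed edge label names the same point of `Σ e, π₀(A_e)`.
[cite: MochizukiSemiAnbd2006, Def. 2.2(i) p.23] -/
private theorem sigma_mk_eqRec_label (OE : ∀ e' : ℋ.graph.Edge, π₀Obj (A.T (ψ.base.edgeMap e')))
    {e' : ℋ.graph.Edge} {e : 𝒦.graph.Edge} (h : ψ.base.edgeMap e' = e) :
    (⟨e, h ▸ OE e'⟩ : Σ e, π₀Obj (A.T e)) = ⟨ψ.base.edgeMap e', OE e'⟩ := by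
  subst h
  rfl

omit [HasBinaryProducts 𝒦.BObj] [αψ.IsEquivalence] in
/-- Bookkeeping: equal re-indexed edge labels at a common edge of `𝕂` give equal points of
`Σ e, π₀(A_e)` (converse of `BObj.eqRec_eq_of_sigma_eq`). [cite: MochizukiSemiAnbd2006, Def. 2.2(i) p.23] -/
private theorem sigma_eq_of_eqRec_label_eq (OE : ∀ e' : ℋ.graph.Edge, π₀Obj (A.T (ψ.base.edgeMap e')))
    {e'₁ e'₂ : ℋ.graph.Edge} {e : 𝒦.graph.Edge} (h₁ : ψ.base.edgeMap e'₁ = e)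
    (h₂ : ψ.base.edgeMap e'₂ = e) (h : (h₁ ▸ OE e'₁ : π₀Obj (A.T e)) = h₂ ▸ OE e'₂) :
    (⟨ψ.base.edgeMap e'₁, OE e'₁⟩ : Σ e, π₀Obj (A.T e)) = ⟨ψ.base.edgeMap e'₂, OE e'₂⟩ := by
  rw [← sigma_mk_eqRec_label ψ A OE h₁, ← sigma_mk_eqRec_label ψ A OE h₂, h]

set_option backward.isDefEq.respectTransparency false in
/-- **THE LOCALISED TIE** ([SemiAnbd] Def. 2.2 (i): the vertices and edges of the covering ARE the
connected components of the `A_u`, `A_e` — here WITHOUT branch alignment and with detection ONLY over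
a set `S` of edges of `𝕂`).  Let `ψ : ℋ → 𝒦` be LOCALLY the covering attached to `A ∈ B(𝒦)`
(`IsFiniteEtaleCoveringOf`), GLOBALLY so through `αψ : B(𝒦)_{/A} ⥲ B(ℋ)`, `e_ψ : ψ^* ≅ (A × −) ⋙ αψ`,
and VERTEX-ALIGNED; assume that every edge-cell `(e, Q)` of `𝔾_A` with `e ∈ S` is DETECTED: some edge
`e′` of `ℋ` over `e` has the constituent `g_{e′}` of the tautological section
`g = αψ(η_{𝟙_A}) ≫ e_ψ⁻¹_A` factoring through `ψ_{e′}^*(Q ↪ A_e)`.  Then the section labels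
`O(w) ∈ π₀(A_{ψ w})`, `O(e′) ∈ π₀(A_{ψ e′})` satisfy: (1) `w ↦ (ψ w, O w)` is INJECTIVE among vertices
the first of which lies over a vertex carrying a branch `b` with `e(b) ∈ S`; (2i) `e′ ↦ (ψ e′, O e′)`
is INJECTIVE among edges the first of which lies over `S`; (2s) every cell `(e, Q)`, `e ∈ S`, is a
label; (3)/(4) `O(w)` (resp. `O(e′)`) is THE component through which `g_w` (resp. `g_{e′}`) factors;
(5) the branch clause of `Hom.IsFiniteEtaleCoveringOf` for `(O, O_E)`.  Proof: (2s) is detection +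
uniqueness of the label; (2i) is mass balance on the finite fibre of `ψ` over `e ∈ S` (in bijection
with `π₀(A_e)` by the local clause); (1): the branches at `w₁` over `b` map injectively ((2i),
`branchMap_injOn`) to the cells over `b` abutting to `O(w₁)`, which are at most as many (the star count
through `cV w₁ ≅ O w₁`), so some branch at `w₁` and some branch at `w₂` carry the cell `(b, Q₀)` for a
chosen `Q₀` under `O(w₁) = O(w₂)` (one exists: the level edge of a point of `O(w₁)`), hence have the
same edge, are equal, and `w₁ = w₂`.  NO connectedness of `ℋ`, `𝒦`, `𝔾_A` is used.
[cite: MochizukiSemiAnbd2006, Def. 2.2(i) p.23] -/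
theorem tie_localLabels_of_sectionE_surjectiveOn (hloc : ψ.IsFiniteEtaleCoveringOf A)
    (hva : ψ.IsVertexAligned) (S : Set 𝒦.graph.Edge)
    (hdet : ∀ e ∈ S, ∀ (Q : π₀Obj (A.T e)),
      ∃ (e' : ℋ.graph.Edge) (Q' : π₀Obj (A.T (ψ.base.edgeMap e'))),
        (⟨ψ.base.edgeMap e', Q'⟩ : Σ e, π₀Obj (A.T e)) = ⟨e, Q⟩ ∧
        ∃ k : (αψ.obj (Over.mk (𝟙 A))).T e' ⟶
            (ψ.φE e' (ψ.base.edgeMap e') rfl).pullback.obj (Q'.1 : 𝒦.E (ψ.base.edgeMap e')),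
          k ≫ (ψ.φE e' (ψ.base.edgeMap e') rfl).pullback.map Q'.1.arrow =
            (αψ.map ((Over.forgetAdjStar A).unit.app (Over.mk (𝟙 A))) ≫ eψ.inv.app A).fT e') :
    ∃ (O : ∀ w : ℋ.graph.Vertex, π₀Obj (A.S (ψ.base.vertexMap w)))
      (OE : ∀ e' : ℋ.graph.Edge, π₀Obj (A.T (ψ.base.edgeMap e'))),
      (∀ (w₁ w₂ : ℋ.graph.Vertex) (b : 𝒦.graph.Branch), 𝒦.graph.edgeOf b ∈ S →
          𝒦.graph.abuts b = some (ψ.base.vertexMap w₁) →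
          (⟨ψ.base.vertexMap w₁, O w₁⟩ : Σ u, π₀Obj (A.S u)) = ⟨ψ.base.vertexMap w₂, O w₂⟩ →
          w₁ = w₂) ∧
      (∀ e'₁ e'₂ : ℋ.graph.Edge, ψ.base.edgeMap e'₁ ∈ S →
          (⟨ψ.base.edgeMap e'₁, OE e'₁⟩ : Σ e, π₀Obj (A.T e)) = ⟨ψ.base.edgeMap e'₂, OE e'₂⟩ →
          e'₁ = e'₂) ∧
      (∀ e ∈ S, ∀ Q : π₀Obj (A.T e), ∃ e' : ℋ.graph.Edge,
          (⟨ψ.base.edgeMap e', OE e'⟩ : Σ e, π₀Obj (A.T e)) = ⟨e, Q⟩) ∧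
      (∀ (w : ℋ.graph.Vertex) (P : π₀Obj (A.S (ψ.base.vertexMap w))),
        P = O w ↔ ∃ k : (αψ.obj (Over.mk (𝟙 A))).S w ⟶
            (ψ.φV w).pullback.obj (P.1 : 𝒦.V (ψ.base.vertexMap w)),
          k ≫ (ψ.φV w).pullback.map P.1.arrow =
            (αψ.map ((Over.forgetAdjStar A).unit.app (Over.mk (𝟙 A))) ≫ eψ.inv.app A).fS w) ∧
      (∀ (e' : ℋ.graph.Edge) (Q : π₀Obj (A.T (ψ.base.edgeMap e'))),
        Q = OE e' ↔ ∃ k : (αψ.obj (Over.mk (𝟙 A))).T e' ⟶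
            (ψ.φE e' (ψ.base.edgeMap e') rfl).pullback.obj (Q.1 : 𝒦.E (ψ.base.edgeMap e')),
          k ≫ (ψ.φE e' (ψ.base.edgeMap e') rfl).pullback.map Q.1.arrow =
            (αψ.map ((Over.forgetAdjStar A).unit.app (Over.mk (𝟙 A))) ≫ eψ.inv.app A).fT e') ∧
      (∀ (b' : ℋ.graph.Branch) (v' : ℋ.graph.Vertex) (h' : ℋ.graph.abuts b' = some v'),
        ∃ f : ((OE (ℋ.graph.edgeOf b')).1 : 𝒦.E (ψ.base.edgeMap (ℋ.graph.edgeOf b'))) ⟶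
            (𝒦.transportE (ψ.base.edgeOf_branchMap b')).obj
              ((𝒦.pull (ψ.base.branchMap b') (ψ.base.vertexMap v')
                (ψ.base.abuts_branchMap b' v' h')).pullback.obj ((O v').1 : 𝒦.V (ψ.base.vertexMap v'))),
          f ≫ (𝒦.transportE (ψ.base.edgeOf_branchMap b')).map
                ((𝒦.pull _ _ (ψ.base.abuts_branchMap b' v' h')).pullback.map (O v').1.arrow ≫
                  (A.ψ (ψ.base.branchMap b') (ψ.base.vertexMap v') (ψ.base.abuts_branchMap b' v' h')).hom) ≫
              eqToHom (𝒦.transportE_obj_T A (ψ.base.edgeOf_branchMap b')) =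
            (OE (ℋ.graph.edgeOf b')).1.arrow) := by
  classical
  -- the labels
  have hU := fun w => existsUnique_component_section_factors ψ A αψ eψ w
  have hUE := fun e' => existsUnique_component_sectionE_factors ψ A αψ eψ e'
  choose O hO using fun w => (hU w).exists
  choose OE hOE using fun e' => (hUE e').exists
  -- (5) abutment compatibility (global clause only), and its branch-clause form
  have h5 : ∀ (b' : ℋ.graph.Branch) (w : ℋ.graph.Vertex) (h' : ℋ.graph.abuts b' = some w),
      A.componentOver (ψ.base.branchMap b') (ψ.base.vertexMap w) (ψ.base.abuts_branchMap b' w h')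
        ((ψ.base.edgeOf_branchMap b').symm ▸ OE (ℋ.graph.edgeOf b')) = O w := fun b' w h' =>
    componentOver_eq_of_section_factors ψ A αψ eψ w b' h' (ψ.base.branchMap b') rfl (O w) (hO w) _
      (sectionE_factors_reindex ψ A αψ eψ _ _ (ψ.edgeMap_edgeOf_of_branchMap b' _ rfl) (OE _) (hOE _))
  have hobr := branchClause_of_componentOver_eq ψ A O OE h5
  -- (2s): every cell over `S` is detected, and the detected label is THE label
  have hsurjS : ∀ e ∈ S, ∀ Q : π₀Obj (A.T e), ∃ e' : ℋ.graph.Edge,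
      (⟨ψ.base.edgeMap e', OE e'⟩ : Σ e, π₀Obj (A.T e)) = ⟨e, Q⟩ := by
    intro e he Q
    obtain ⟨e', Q', hQ', hk⟩ := hdet e he Q
    refine ⟨e', ?_⟩
    have hQ'E : Q' = OE e' := (hUE e').unique hk (hOE e')
    rw [← hQ'E]
    exact hQ'
  -- the local description
  obtain ⟨hprop, cV, cE, hbijV, hbijE, hαV, -, hbr⟩ := _root_.id hloc
  -- (2i): mass balance on the finite fibre over each `e ∈ S`
  have hinjS : ∀ e'₁ e'₂ : ℋ.graph.Edge, ψ.base.edgeMap e'₁ ∈ S →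
      (⟨ψ.base.edgeMap e'₁, OE e'₁⟩ : Σ e, π₀Obj (A.T e)) = ⟨ψ.base.edgeMap e'₂, OE e'₂⟩ →
      e'₁ = e'₂ := by
    intro e'₁ e'₂ he h
    obtain ⟨E, -⟩ := nonempty_edgeFiber_equiv_π₀Obj ψ A cE hbijE (ψ.base.edgeMap e'₁)
    exact eq_of_sigma_eq_of_surjOn_fiber ψ.base.edgeMap (fun e => π₀Obj (A.T e))
      (ψ.base.edgeMap e'₁) OE ⟨E⟩ (hsurjS _ he) rfl h
  -- the star count at `(w, b)` for the SECTION labels (through `cV w ≅ O w`)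
  have hcard : ∀ (w : ℋ.graph.Vertex) (b : 𝒦.graph.Branch)
      (hb : 𝒦.graph.abuts b = some (ψ.base.vertexMap w)),
      Nat.card {Q : π₀Obj (A.T (𝒦.graph.edgeOf b)) //
          A.componentOver b (ψ.base.vertexMap w) hb Q = O w} ≤
        Nat.card {b' : ℋ.graph.Branch // ℋ.graph.abuts b' = some w ∧ ψ.base.branchMap b' = b} := by
    intro w b hb
    obtain ⟨αw, hαw, ⟨ew⟩⟩ := hαV w
    haveI := hαw
    haveI := (cV w).2
    obtain ⟨i, -⟩ := nonempty_iso_of_localGlobalSection ψ A αψ eψ hva w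
      ((cV w).1 : 𝒦.V (ψ.base.vertexMap w)) (cV w).1.arrow αw ew (O w) (hO w)
    calc Nat.card {Q : π₀Obj (A.T (𝒦.graph.edgeOf b)) //
            A.componentOver b (ψ.base.vertexMap w) hb Q = O w}
        = Nat.card {Q : π₀Obj (A.T (𝒦.graph.edgeOf b)) //
            Q.1 ≤ A.branchImage b (ψ.base.vertexMap w) hb (O w).1} :=
          Nat.card_congr (Equiv.subtypeEquivRight fun Q =>
            A.componentOver_eq_iff_le_branchImage b _ hb Q (O w))
      _ = Nat.card {Q : π₀Obj (A.T (𝒦.graph.edgeOf b)) //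
            Q.1 ≤ A.branchImage b (ψ.base.vertexMap w) hb (cV w).1} :=
          (A.natCard_le_branchImage_eq_of_iso b _ hb (cV w) (O w) i).symm
      _ = Nat.card {Q : π₀Obj (A.T (𝒦.graph.edgeOf b)) //
            A.componentOver b (ψ.base.vertexMap w) hb Q = cV w} :=
          Nat.card_congr (Equiv.subtypeEquivRight fun Q =>
            (A.componentOver_eq_iff_le_branchImage b _ hb Q (cV w)).symm)
      _ ≤ _ := natCard_componentOver_eq_le_natCard_branches ψ A cV cE hprop hbijV.1 hbijE hbr w b hb
  -- star surjectivity over an `S`-branch: every cell over `b` abutting to `O w` is carried by a branch at `w`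
  have hstar : ∀ (w : ℋ.graph.Vertex) (b : 𝒦.graph.Branch), 𝒦.graph.edgeOf b ∈ S →
      ∀ (hb : 𝒦.graph.abuts b = some (ψ.base.vertexMap w))
        (Q : π₀Obj (A.T (𝒦.graph.edgeOf b))), A.componentOver b (ψ.base.vertexMap w) hb Q = O w →
      ∃ (b' : ℋ.graph.Branch) (_ : ℋ.graph.abuts b' = some w) (p : ψ.base.branchMap b' = b),
        ((ψ.edgeMap_edgeOf_of_branchMap b' b p) ▸ OE (ℋ.graph.edgeOf b') :
          π₀Obj (A.T (𝒦.graph.edgeOf b))) = Q := by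
    intro w b hbS hb Q hQ
    let Src := {b' : ℋ.graph.Branch // ℋ.graph.abuts b' = some w ∧ ψ.base.branchMap b' = b}
    let Tgt := {Q : π₀Obj (A.T (𝒦.graph.edgeOf b)) // A.componentOver b (ψ.base.vertexMap w) hb Q = O w}
    let lab : Src → Tgt := fun b' =>
      ⟨(ψ.edgeMap_edgeOf_of_branchMap b'.1 b b'.2.2) ▸ OE (ℋ.graph.edgeOf b'.1),
        componentOver_localLabel_eq ψ A O OE hobr b'.1 w b'.2.1 b b'.2.2⟩
    have hlab_inj : Function.Injective lab := by
      intro b'₁ b'₂ hl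
      have h1 : ((ψ.edgeMap_edgeOf_of_branchMap b'₁.1 b b'₁.2.2) ▸ OE (ℋ.graph.edgeOf b'₁.1) :
          π₀Obj (A.T (𝒦.graph.edgeOf b))) =
          (ψ.edgeMap_edgeOf_of_branchMap b'₂.1 b b'₂.2.2) ▸ OE (ℋ.graph.edgeOf b'₂.1) :=
        congrArg Subtype.val hl
      have heS : ψ.base.edgeMap (ℋ.graph.edgeOf b'₁.1) ∈ S := by
        rw [ψ.edgeMap_edgeOf_of_branchMap b'₁.1 b b'₁.2.2]; exact hbS
      have he : ℋ.graph.edgeOf b'₁.1 = ℋ.graph.edgeOf b'₂.1 :=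
        hinjS _ _ heS (sigma_eq_of_eqRec_label_eq ψ A OE _ _ h1)
      exact Subtype.ext (ψ.base.branchMap_injOn _ _ he (b'₁.2.2.trans b'₂.2.2.symm))
    haveI : Finite Tgt := inferInstance
    have hbij : Function.Bijective lab := hlab_inj.bijective_of_nat_card_le (hcard w b hb)
    obtain ⟨⟨b', hb'w, hb'b⟩, hl⟩ := hbij.2 ⟨Q, hQ⟩
    exact ⟨b', hb'w, hb'b, congrArg Subtype.val hl⟩
  -- (1): vertex-label injectivity over the ends of `S`-edges
  have hinjV : ∀ (w₁ w₂ : ℋ.graph.Vertex) (b : 𝒦.graph.Branch), 𝒦.graph.edgeOf b ∈ S →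
      𝒦.graph.abuts b = some (ψ.base.vertexMap w₁) →
      (⟨ψ.base.vertexMap w₁, O w₁⟩ : Σ u, π₀Obj (A.S u)) = ⟨ψ.base.vertexMap w₂, O w₂⟩ →
      w₁ = w₂ := by
    intro w₁ w₂ b hbS hb₁ hsig
    have hu : ψ.base.vertexMap w₁ = ψ.base.vertexMap w₂ := congrArg Sigma.fst hsig
    have hb₂ : 𝒦.graph.abuts b = some (ψ.base.vertexMap w₂) := hu ▸ hb₁
    -- a cell `Q₀` over `b` abutting to `O w₁`: the level edge of a point of `O w₁` (identity frame)
    let Fe := GaloisCategory.getFiberFunctor (𝒦.E (𝒦.graph.edgeOf b))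
    let F : 𝒦.V (ψ.base.vertexMap w₁) ⥤ FintypeCat.{v₁} :=
      (𝒦.pull b (ψ.base.vertexMap w₁) hb₁).pullback ⋙ Fe
    haveI : FiberFunctor F := fiberFunctor_comp_of_exact _ Fe
    haveI := (O w₁).2
    obtain ⟨x₀⟩ := nonempty_fiber_of_isConnected F ((O w₁).1 : 𝒦.V (ψ.base.vertexMap w₁))
    obtain ⟨Q₀, hQ₀⟩ := exists_eComp_mem A F b hb₁ Fe (Iso.refl _)
      (F.map (O w₁).1.arrow x₀)
    have hQ₀w₁ : A.componentOver b (ψ.base.vertexMap w₁) hb₁ Q₀ = O w₁ :=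
      componentOver_eq_of_mem A F b hb₁ Fe (Iso.refl _) hQ₀ ⟨x₀, rfl⟩
    have hQ₀w₂ : A.componentOver b (ψ.base.vertexMap w₂) hb₂ Q₀ = O w₂ := by
      have h12 := A.sigma_componentOver_eq b (ψ.base.vertexMap w₁) (ψ.base.vertexMap w₂) hb₁ hb₂ Q₀
      rw [hQ₀w₁] at h12
      obtain ⟨-, h2⟩ := Sigma.mk.inj_iff.mp (h12.symm.trans hsig)
      exact eq_of_heq h2
    -- a branch at `w₁` and a branch at `w₂` carrying `(b, Q₀)`
    obtain ⟨b'₁, hb'₁w, p₁, hl₁⟩ := hstar w₁ b hbS hb₁ Q₀ hQ₀w₁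
    obtain ⟨b'₂, hb'₂w, p₂, hl₂⟩ := hstar w₂ b hbS hb₂ Q₀ hQ₀w₂
    -- same edge label over `e(b) ∈ S`, hence the same edge, hence the same branch
    have heS : ψ.base.edgeMap (ℋ.graph.edgeOf b'₁) ∈ S := by
      rw [ψ.edgeMap_edgeOf_of_branchMap b'₁ b p₁]; exact hbS
    have he : ℋ.graph.edgeOf b'₁ = ℋ.graph.edgeOf b'₂ :=
      hinjS _ _ heS (sigma_eq_of_eqRec_label_eq ψ A OE _ _ (hl₁.trans hl₂.symm))
    have hbb : b'₁ = b'₂ := ψ.base.branchMap_injOn _ _ he (p₁.trans p₂.symm)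
    subst hbb
    exact Option.some_injective _ (hb'₁w.symm.trans hb'₂w)
  exact ⟨O, OE, hinjV, hinjS, hsurjS,
    fun w P => ⟨fun h => h ▸ hO w, fun hP => (hU w).unique hP (hO w)⟩,
    fun e' Q => ⟨fun h => h ▸ hOE e', fun hQ => (hUE e').unique hQ (hOE e')⟩, hobr⟩

end Hom

end SemiGraphOfAnabelioids

end Literature.AnabelianGeometry.SemiGraphs
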